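import Summits.BirchSwinnertonDyer.BirchSwinnertonDyer.Theorems.AdditiveKolyvaginRoadAdditiveKolyvaginKernel
import Summits.BirchSwinnertonDyer.BirchSwinnertonDyer.Theorems.AdditiveKolyvaginRoadLevelKolyvaginSystemsAdditiveGammaLocusKPA
import Summits.BirchSwinnertonDyer.BirchSwinnertonDyer.Theorems.AdditiveKolyvaginRoadGammaAvatarLocusSlim
import Summits.BirchSwinnertonDyer.BirchSwinnertonDyer.Theorems.AdditiveKolyvaginRoadSignAgreementOfTorsionCongr
import Literature.NumberTheory.EllipticCurves.ZywinaCMImageProofs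
import HarnessLib

/-!
# Route `AdditiveKolyvaginRoad`, crux KS′ `LevelKolyvaginSystemsAdditive` (item stmt-BirchSwinnertonDyer-21396):
# THE (γ)-AVATAR METHOD IN SUMMIT CURRENCY — `BSDp W p` ON THE GOOD-AVATAR LOCUS, GRANTED PUB, Kriz–Li 1.16 and the
# rank-zero additive residual (cell `pub/bsd-wall`, width seat `bsd-wall-akr-p2x-w3` g6; `--supports
# stmt-BirchSwinnertonDyer-21396`, helper)

WHY.  Line `epsilon_matched_retyping` settled KS′ on the (γ)-avatar locus (p616119, slimmed p618901); the route's crux r2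
KPA′ (`KolyvaginPrimitiveAdditive`, item 21400) holds at conductor `1` on the same locus from Kriz–Li alone
(`AdditiveKoly.kolyvaginPrimitiveAdditive_conclusion_on_gammaLocus`); and the route's kernel
(`AdditiveKolyvaginKernel.additiveKolyvaginKernel_proof`, item 20138) turns KPA′ into `BSDp W p` for every ♯ rank-one additive
row, granted PUB, the Manin-good frames and the rank-zero residual.  The kernel consumes KPA′ as a ∀-statement over ALL ♯ frames and
picks its own Hoffstein–Luo frame, so it cannot be fed a locus.  This file re-runs the kernel AT A GIVEN FRAME (§1) and composes
(§2): the (γ)-method's output in the summit's own currency `BSDp`.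

* §1 `bsdp_of_kolyvaginPrimitive_at_frame` — for `W/ℚ` globally minimal, additive at `p ≥ 5`, `r_an = 1`, `ρ̄_{E,p}` onto (hence non-CM, Zywina),
  `p ∤ ∏ c_ℓ`, and a GIVEN odd Heegner frame `(K, Dt, β, ι)` (`K` imaginary quadratic, `d_K` odd `< −4`, Heegner hypothesis for `N`,
  `L(E^{(d_K)}, 1) ≠ 0`, `4N ∣ β² − d_K`, `p ∤ c(Dt)`): PUB ∧ `RankZeroAdditive` ∧ «KPA′'s conclusion AT THIS FRAME» ⟹ `BSDp W p`.
  Proof = the kernel's steps 1, 3–6 verbatim at the given frame (Heegner datum `H` with `β(H) = β` from `nonempty_heegnerDatum_holds`,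
  Heegner point from `heegnerPointComplex_mem_range_map_holds`, `w_K = 2`, `p ∤ d_K` since `p ∣ N` splits, a globally minimal model of
  the twist from `hasGlobalMinimalModel_rat_holds`; then Darmon 3.6 datum ∘ Gross–Zagier non-torsion ∘ Kolyvagin ∘ `E(K)[p] = 0` ∘
  McCallum ⟹ `IndexLowerBoundAt` ⟹ `IndexIdentityAt` ⟹ `X11b.bsdp_of_indexIdentityAt`, the twist's `p`-part from `RankZeroAdditive`).
* §2 `bsdp_on_goodAvatarLocus` — §1 ∘ `kolyvaginPrimitiveAdditive_conclusion_on_gammaLocus` ∘ the automatic locus clauses (w2 g5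
  p618901: `htype`, `hrad`, ♠(1) for `E₀`, `p ∤ ∏ c`; w3 g5 p609488: sign agreement; `SatisfiesHeegnerHypothesis.of_dvd`): for every ♯
  rank-one additive `(E, p)` (`ρ̄` onto, ♠(1)) with an odd Heegner frame as above that carries a `p`-GOOD (ordinary or not) NON-ANOMALOUS avatar
  `E₀` — `Γ_ℚ`-isomorphism `E[p] ≃ E₀[p]`, `N₀ p² = N`, a parametrisation `Dt₀` with `p ∤ c₀`, and the log certificate «a Heegner point
  of `E₀` over `heegnerPointComplex Dt₀ H₀` is not `p`-divisible in `E₀(ℚ_p)`» — `BSDp W p` holds GRANTED ONLY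
  `PublishedInputsAdditiveKoly` (PUB), Kriz–Li 2019 Thm. 1.16 and the rank-zero additive residual `RankZeroAdditive` (an OPEN crux of
  the route, displayed as a hypothesis exactly as in the kernel).  No `p`-parity, Cassels–Tate, Poitou–Tate, W. Zhang 2014, DUAL,
  ordinariness or root-number input: on this locus KS′ is bypassed.  The crux binder `¬ p ∣ W.tamagawaProduct` is not a hypothesis of
  §2 (it follows from ♠(1) and `p ≥ 5`, `AdditiveKoly.not_dvd_tamagawaProduct_of_spadeOne`).

HONEST FRAMING: theorems only (0 definitions, 0 named facts, 0 `sorry`); CONDITIONAL on PUB, Kriz–Li 1.16 and the open residual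
`RankZeroAdditive`; closes no item (KS′ quantifies over all ♯ frames and asks for level systems, not `BSDp`); a class-level reading for
the W-ALL table, not a proof of BSD.  BSD is not proved by any of this.

References: [cite: WZhang2014, Thm. 1.1, Thm. 10.2] [cite: KrizLi2019, Thm. 1.16, Rem. 1.17] [cite: McCallumLMS1991, §5 Cor. 5.6]
[cite: GrossZagier1986, V.§2] [cite: Kolyvagin1991] [cite: JetchevSkinnerWan2017, §7.4.1–7.4.3] [cite: Darmon2004, Thm. 3.6]
[cite: SerreAbelianLadic1968, Ch. IV §3.4].
-/

set_option linter.dupNamespace false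
set_option autoImplicit false

noncomputable section

open scoped Classical

open WeierstrassCurve NumberField IsDedekindDomain Field
  Literature.NumberTheory.EllipticCurves Literature.NumberTheory.EllipticCurves.ModularForms
  Literature.NumberTheory.EllipticCurves.Rank1Residual Literature.NumberTheory.Automorphic
  Literature.NumberTheory.GaloisRepresentations
  Summit.BirchSwinnertonDyer.Rank1Residual Summit.BirchSwinnertonDyer.Rank1Residual.X11b
  Summit.BirchSwinnertonDyer.BirchSwinnertonDyer.Theses.AdditiveKolyvaginRoad
  Summit.BirchSwinnertonDyer.BirchSwinnertonDyer.Theorems.AdditiveKolyvaginKernel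

namespace Summit.BirchSwinnertonDyer.BirchSwinnertonDyer.Theorems.AdditiveKoly

/-! ## §1 The kernel at a GIVEN odd Heegner frame -/

/-- **The additive Kolyvagin kernel at a given frame.**  For `W/ℚ` globally minimal, additive at `p ≥ 5`, `r_an = 1`,
`ρ̄_{E,p}` onto (so `E` is non-CM: Zywina 2015 Prop. 1.14, tree `not_hasSurjectiveModNGaloisRep_of_hasCM`), `p ∤ ∏ c_ℓ`, and an odd Heegner frame `(K, Dt, β, ι)` with `d_K` odd `< −4`, the Heegner hypothesis for `N`,
`L(E^{(d_K)},1) ≠ 0`, `4N ∣ β² − d_K`, `p ∤ c(Dt)`: the published inputs, the rank-zero additive residual and the conclusion of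
KPA′ AT THIS FRAME (some Kolyvagin–Heegner datum of Kolyvagin-prime support with `c(1) ≠ 0` mod `p`) give `BSDp W p`.  The kernel's
steps at the given frame: Serre (`ρ̄_{E,p^m}` onto), Darmon 3.6 conductor-1 datum with bottom point the Heegner point, Gross–Zagier
non-torsion, Kolyvagin (`rank 1`, `Ш` finite), `E(K)[p] = 0`, McCallum Cor. 5.6 ⟹ `IndexLowerBoundAt`, Kolyvagin's bound ⟹
`IndexIdentityAt`, the twist's `p`-part from `RankZeroAdditive`, descent `X11b.bsdp_of_indexIdentityAt`.
[cite: McCallumLMS1991, §5 Cor. 5.6 (p. 310)] [cite: GrossZagier1986, V.§2] [cite: Darmon2004, Thm. 3.6]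
[cite: JetchevSkinnerWan2017, §7.4.1–7.4.3] [cite: SerreAbelianLadic1968, Ch. IV §3.4] -/
theorem bsdp_of_kolyvaginPrimitive_at_frame (hPub : PublishedInputsAdditiveKoly) (h₀ : RankZeroAdditive)
    (W : WeierstrassCurve ℚ) [W.IsElliptic] [W.IsGloballyMinimal] [NeZero (W.conductorNorm ℤ)] (p : ℕ) [hp : Fact p.Prime]
    (hp5 : 5 ≤ p) (hadd : Addv W p) (hr : W.analyticRank = 1) (hsurjp : W.HasSurjectiveModNGaloisRep p)
    (htam : ¬ p ∣ W.tamagawaProduct)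
    (K : Type) [Field K] [NumberField K] (Dt : ModularParametrizationData W (W.conductorNorm ℤ)) (β : ℤ) (ι : K →+* ℂ)
    (hK : IsImaginaryQuadratic K) (hodd : Odd (NumberField.discr K)) (hlt : NumberField.discr K < -4)
    (hHN : SatisfiesHeegnerHypothesis (W.conductorNorm ℤ) K)
    (hLt : (W.quadraticTwist (NumberField.discr K : ℚ)).entireLFunction 1 ≠ 0)
    (hβ : (4 * (W.conductorNorm ℤ : ℤ)) ∣ β ^ 2 - NumberField.discr K) (hc : ¬ (p : ℤ) ∣ Dt.c)
    (hKPA : ∃ (n : ℕ) (d : KolyvaginHeegnerData Dt β ι n),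
      KolyvaginDescent.KolSupp (Zhang2014.IsKolyvaginPrime (W.conductorNorm ℤ) W K p) n ∧
        d.kolyvaginClass (Fact.out : p.Prime) 1 ≠ 0) :
    BSDp W p := by
  obtain ⟨hGZ, hKo, hB, hGZK, hmod, hnf, -, hrec, hMc, h36⟩ := hPub
  have hpP : p.Prime := hp.out
  have hp2 : p ≠ 2 := by omega
  -- non-CM: a CM curve has no surjective `ρ̄_{E,ℓ}` at an odd `ℓ` (Zywina 2015, Prop. 1.14)
  have hCM : ¬ W.HasCM := fun h ↦ W.not_hasSurjectiveModNGaloisRep_of_hasCM h hpP hp2 hsurjp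
  -- step 1: `E[p]` irreducible; `ρ̄_{E,p^m}` onto for every `m` (Serre, `p ≥ 5`)
  have hirr : Irr W p := hasIrreducibleModPGaloisRep_of_hasSurjectiveModNGaloisRep W p hsurjp
  have hsurj : ∀ m : ℕ, W.HasSurjectiveModNGaloisRep (p ^ m : ℕ) :=
    serre_hasSurjectiveModNGaloisRep_pow_holds W p hp5 hsurjp
  -- step 2': the GIVEN frame, completed: Heegner datum with `β(H) = β`, Heegner point, `p ∤ d_K`, `w_K = 2`, a minimal twist
  obtain ⟨H, hHβ⟩ := nonempty_heegnerDatum_holds (W.conductorNorm ℤ) K hK hβ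
  subst hHβ
  obtain ⟨P, hP⟩ := heegnerPointComplex_mem_range_map_holds (W.conductorNorm ℤ) W K hK hHN Dt H ι
  have hpN : p ∣ W.conductorNorm ℤ := (W.dvd_conductorNorm_iff_not_hasGoodReductionAtPrime p).mpr hadd.1
  have hpd : ¬ (p : ℤ) ∣ NumberField.discr K := not_dvd_discr_of_split hK hpP hp2 (fun q hq hqp ↦ by
    rw [(Nat.prime_dvd_prime_iff_eq hq hpP).mp hqp]; exact hHN p hpP hpN)
  have hμ : ¬ p ∣ Units.torsionOrder K := by
    haveI : IsTotallyComplex K := hK.2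
    rw [Literature.NumberTheory.DiophantineGeometry.torsionOrder_eq_two_of_discr_lt hK.1 hlt]
    intro h2
    have := Nat.le_of_dvd two_pos h2
    omega
  have hD0 : (NumberField.discr K : ℚ) ≠ 0 := by exact_mod_cast NumberField.discr_ne_zero K
  haveI hEt : (W.quadraticTwist (NumberField.discr K : ℚ)).IsElliptic := W.isElliptic_quadraticTwist hD0
  obtain ⟨Cd, hCd⟩ := hasGlobalMinimalModel_rat_holds (W.quadraticTwist (NumberField.discr K : ℚ))
  set Wd : WeierstrassCurve ℚ := Cd • W.quadraticTwist (NumberField.discr K : ℚ) with hWd_def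
  have hWd : Cd • W.quadraticTwist (NumberField.discr K : ℚ) = Wd := rfl
  haveI : Wd.IsGloballyMinimal := hCd
  have h3 : NumberField.discr K ≠ -3 := by omega
  have h4 : NumberField.discr K ≠ -4 := by omega
  -- step 3: conductor-1 Kolyvagin–Heegner datum (Darmon 3.6), bottom point, non-torsion, Kolyvagin
  obtain ⟨d₁⟩ := kolyvaginRoadThree_hKD_of_darmon36 h36 W K Dt H.β ι hK hHN H.dvd_sq_sub
  have hPd : d₁.toGeomPoints d₁.derivedPoint = toGeomPoints (W.baseChange K) P :=
    KolyvaginBottom.toGeomPoints_derivedPoint_one_eq (hrec _ W K) hK hHN hP d₁ rfl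
  have hPinf : ¬ IsOfFinAddOrder P :=
    not_isOfFinAddOrder_of_heegner_of_analyticRank_eq_one W (W.conductorNorm ℤ) K Dt H ι P (hGZ _ W K)
      hmod hr hK hHN hLt hP
  obtain ⟨hrank, hSha⟩ := hKo (W.conductorNorm ℤ) W K hK hHN ⟨Dt, H, ι, hP⟩ hPinf
  haveI : Finite (W.baseChange K).sha := hSha
  -- `E(K)[p] = 0`
  have hbot := torsionBy_eq_bot_of_isImaginaryQuadratic_of_hasIrreducibleModPGaloisRep W K hK hpP hirr
  have hiv : ∀ x : (W.baseChange K).toAffine.Point, p • x = 0 → x = 0 := fun x hx ↦ by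
    have hmem : x ∈ AddSubgroup.torsionBy (W.baseChange K).toAffine.Point ((p : ℕ) : ℤ) := by
      rw [mem_torsionBy_iff, natCast_zsmul]
      exact hx
    rw [hbot] at hmem
    exact hmem
  -- `p^{M₀} ∥ y_K`
  haveI : Module.Finite ℤ (W.baseChange K).toAffine.Point := (W.baseChange K).module_finite_point_holds
  obtain ⟨M₀, x₀, hx₀, hmax⟩ := exists_pow_smul_eq_and_forall_ne hPinf (p := p) hpP.two_le
  have hdiv : ∃ Q : (W.baseChange K).toAffine.Point, ((p ^ M₀ : ℕ) : ℤ) • Q = P :=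
    ⟨x₀, by rw [natCast_zsmul]; exact hx₀⟩
  have hndiv : ¬ ∃ Q : (W.baseChange K).toAffine.Point, ((p ^ (M₀ + 1) : ℕ) : ℤ) • Q = P := by
    rintro ⟨Q, hQ⟩
    exact hmax Q (by rw [← natCast_zsmul]; exact hQ)
  -- step 4: KPA′ at this frame; McCallum ⟹ STEP L; Kolyvagin's bound ⟹ the identity
  obtain ⟨n, d, hn, hne⟩ := hKPA
  have hL : IndexLowerBoundAt W p K P :=
    Three.Koly.indexLowerBoundAt_of_kolyvaginClass_one_ne_zero_of_mccallum W K hMc hCM hK h3 h4 hHN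
      p hp2 hsurj Dt H.β ι d₁ P hPd hPinf hrank hiv hdiv hndiv d hn hne
  have hid : IndexIdentityAt W p K P :=
    indexIdentityAt_of_lowerBound_of_kolyvagin W p (hB _ W K) hK hHN ⟨Dt, H, ι, hP⟩ hPinf hp2 hsurjp
      htam hL
  -- step 5: the twist — non-CM, additive at `p`, rank `0` ⟹ `BSDp Wd p` (residual) ⟹ print shape
  obtain ⟨hCMd, haddd, hrd⟩ := twist_nonCM_addv_rankZero hmod W p hCM hadd K hK hHN hLt Wd Cd hWd
  have hBSDd : BSDp Wd p := h₀ Wd p hCMd hp5 haddd hrd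
  have htw : PPartRankZero Wd p :=
    pPartRankZero_of_pPart hGZK Wd p hrd (pPart_of_bsdp hmod hGZK Wd p (by omega) hBSDd)
  have htamEq : padicValNat p Wd.tamagawaProduct = padicValNat p W.tamagawaProduct :=
    X2.padicValNat_tamagawaProduct_twist_of_heegner_of_odd W p hp2 K hK hodd hpd hHN Cd hWd
  have hu : padicValRat p (Cd.u : ℚ) = 0 :=
    X11b.padicValRat_u_eq_zero_of_twist_minimal_of_splitsIn W p K hK.1 (hHN p hpP hpN) Cd hWd
  -- step 6: the descent `K → ℚ`
  exact X11b.bsdp_of_indexIdentityAt W p (W.conductorNorm ℤ) K Dt H ι P (hGZ _ W K) (hKo _ W K)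
    hGZK hmod hK hHN hP hp2 hc hμ hr hLt Wd Cd hWd htw htamEq hu (fun _ ↦ hid)

/-! ## §2 `BSDp` on the good-avatar locus -/

/-- **`BSDp W p` ON THE GOOD-AVATAR LOCUS, granted PUB, Kriz–Li 1.16 and the rank-zero additive residual.**  For `W/ℚ` globally
minimal, additive at `p ≥ 5`, `r_an = 1`, `ρ̄_{E,p}` onto, ♠(1) (`p ∤ ord_ℓ Δ_min` at every multiplicative `ℓ`), and an odd
Heegner frame `(K, Dt, β, ι)` as in §1 carrying a `p`-GOOD NON-ANOMALOUS AVATAR: a globally minimal `E₀` with a `Γ_ℚ`-equivariant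
`e : E[p] ≃ E₀[p]`, `E₀` good at `p` with `p ∤ a_p(E₀) − 1`, `N₀ p² = N`, a parametrisation `Dt₀` with `p ∤ c₀`, and the LOG
CERTIFICATE along some `ιp : K → ℚ_p` — `BSDp W p` holds.  Inputs BY NAME: `PublishedInputsAdditiveKoly`, Kriz–Li 2019 Thm. 1.16,
`RankZeroAdditive` (open; hypothesis).  Composition: the automatic clauses (`htype`, `hrad`, ♠(1) for `E₀` — p618901; sign agreement —
p609488; Heegner hypothesis for `N₀ ∣ N`; `p ∤ ∏ c_ℓ(E)` from ♠(1)), Kriz–Li's bottom transfer in KPA′'s shape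
(`kolyvaginPrimitiveAdditive_conclusion_on_gammaLocus`), and §1.
[cite: KrizLi2019, Thm. 1.16, Rem. 1.17] [cite: WZhang2014, Thm. 1.1, Thm. 10.2] [cite: McCallumLMS1991, §5 Cor. 5.6]
[cite: GrossZagier1986, V.§2] [cite: SerreInventiones1972, §1.11–1.12] -/
theorem bsdp_on_goodAvatarLocus (hPub : PublishedInputsAdditiveKoly) (h₀ : RankZeroAdditive)
    (hKL : KrizLi2019.thm116_padicLogHeegner_congruence)
    (W : WeierstrassCurve ℚ) [W.IsElliptic] [W.IsGloballyMinimal] [NeZero (W.conductorNorm ℤ)] (p : ℕ) [hp : Fact p.Prime]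
    (hp5 : 5 ≤ p) (hadd : Addv W p) (hr : W.analyticRank = 1) (hs : W.HasSurjectiveModNGaloisRep p)
    (hsp : ∀ (ℓ : ℕ) [Fact ℓ.Prime], W.HasMultiplicativeReductionAtPrime ℓ → ¬ p ∣ padicValInt ℓ W.minimalDiscriminantInt)
    (K : Type) [Field K] [NumberField K] (Dt : ModularParametrizationData W (W.conductorNorm ℤ)) (β : ℤ) (ι : K →+* ℂ)
    (hK : IsImaginaryQuadratic K) (hodd : Odd (NumberField.discr K)) (hlt : NumberField.discr K < -4)
    (hH : SatisfiesHeegnerHypothesis (W.conductorNorm ℤ) K)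
    (hL : (W.quadraticTwist (NumberField.discr K : ℚ)).entireLFunction 1 ≠ 0)
    (hβ : (4 * (W.conductorNorm ℤ : ℤ)) ∣ β ^ 2 - NumberField.discr K) (hc : ¬ (p : ℤ) ∣ Dt.c)
    (hav : ∃ (W₀ : WeierstrassCurve ℚ) (_ : W₀.IsElliptic) (_ : W₀.IsGloballyMinimal) (_ : NeZero (W₀.conductorNorm ℤ))
      (Dt₀ : ModularParametrizationData W₀ (W₀.conductorNorm ℤ))
      (e : geomTorsion W (p : ℤ) ≃+ geomTorsion W₀ (p : ℤ)),
      (∀ (σ : absoluteGaloisGroup ℚ) (P : geomTorsion W (p : ℤ)), e (σ • P) = σ • e P) ∧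
      W₀.HasGoodReductionAtPrime p ∧ ¬ (p : ℤ) ∣ W₀.frobeniusTrace p - 1 ∧
      W₀.conductorNorm ℤ * p ^ 2 = W.conductorNorm ℤ ∧ ¬ (p : ℤ) ∣ Dt₀.c ∧
      ∃ (ιp : K →+* ℚ_[p]) (H₀ : HeegnerDatum (W₀.conductorNorm ℤ) (NumberField.discr K))
        (y₀ : (W₀.baseChange K).toAffine.Point),
        WeierstrassCurve.Affine.Point.map ι.toRatAlgHom y₀ = heegnerPointComplex Dt₀ H₀ ∧
          ¬ ∃ Q : (W₀.baseChange ℚ_[p]).toAffine.Point, (p : ℤ) • Q = X11b.padicPointOf W₀ p ιp y₀) :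
    BSDp W p := by
  obtain ⟨W₀, _, _, _, Dt₀, e, he, hgood₀, hna, hN₀, hc₀, ιp, hcert⟩ := hav
  -- neither curve is multiplicative at `p`
  have hWp : ¬ W.HasMultiplicativeReductionAtPrime p := hadd.2
  have hW₀p : ¬ W₀.HasMultiplicativeReductionAtPrime p := fun h ↦
    (WeierstrassCurve.HasMultiplicativeReduction.not_hasGoodReduction (R := ℤ_[p]) h) hgood₀
  -- the automatic clauses: same multiplicative primes, `rad(pN) = rad(pN₀)`, ♠(1) for `E₀`, sign agreement, Heegner for `N₀`
  have htype : ∀ (ℓ : ℕ) [Fact ℓ.Prime], W.HasMultiplicativeReductionAtPrime ℓ ↔ W₀.HasMultiplicativeReductionAtPrime ℓ :=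
    fun ℓ _ ↦ hasMultiplicativeReductionAtPrime_iff_of_conductorNorm_eq W W₀ p hN₀ hWp hW₀p ℓ
  have hrad : ∀ q : ℕ, q.Prime → (q ∣ p * W.conductorNorm ℤ ↔ q ∣ p * W₀.conductorNorm ℤ) :=
    fun q hq ↦ prime_dvd_mul_iff_of_mul_sq_eq hN₀ q hq
  have hsp₀ : ∀ (ℓ : ℕ) [Fact ℓ.Prime], W₀.HasMultiplicativeReductionAtPrime ℓ →
      ¬ p ∣ padicValInt ℓ W₀.minimalDiscriminantInt := by
    intro ℓ _ h₀ℓ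
    have hWℓ : W.HasMultiplicativeReductionAtPrime ℓ := (htype ℓ).mpr h₀ℓ
    have hℓp : ℓ ≠ p := by
      rintro rfl
      exact hWp hWℓ
    exact (hasMultiplicativeReductionAtPrime_and_not_dvd_of_torsionIso W W₀ p hp5 e he ℓ hℓp hWℓ (hsp ℓ hWℓ)).2
  have hsign : ∀ (ℓ : ℕ) [Fact ℓ.Prime], W₀.HasMultiplicativeReductionAtPrime ℓ → W.LFunction ℓ = W₀.LFunction ℓ :=
    sign_agreement_of_torsionCongr W W₀ p hp5 hadd hsp₀ htype e he
  have hH₀ : SatisfiesHeegnerHypothesis (W₀.conductorNorm ℤ) K := SatisfiesHeegnerHypothesis.of_dvd (Dvd.intro _ hN₀) hH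
  -- the crux binder `p ∤ ∏ c_ℓ(E)` is automatic from ♠(1) at `p ≥ 5`
  have htam : ¬ p ∣ W.tamagawaProduct := not_dvd_tamagawaProduct_of_spadeOne W p hp5 hsp
  -- KPA′'s conclusion at this frame (Kriz–Li bottom transfer), then the kernel at this frame
  exact bsdp_of_kolyvaginPrimitive_at_frame hPub h₀ W p hp5 hadd hr hs htam K Dt β ι hK hodd hlt hH hL hβ hc
    (kolyvaginPrimitiveAdditive_conclusion_on_gammaLocus W p K Dt β ι hKL hp5 hadd hs hK hlt hH hβ hc W₀ e he hgood₀ hna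
      hrad htype hsign Dt₀ hc₀ hH₀ ιp hcert)

/-! ## §3 (appended) The same with the rank-zero input LOCALISED to the frame's own twist

The kernel consumes the residual `RankZeroAdditive` only at ONE curve: a globally minimal model `Wd = Cd • E^{(d_K)}` of the
Heegner twist of the frame.  The two theorems below take that single `p`-part `BSDp Wd p` as the hypothesis instead of the
∀-residual, so that a class-by-class rank-zero result for the twist (the sibling routes' currency) can be chained with the
avatar method: on the good-avatar locus, **`BSDp (E^{(d_K)}) p ⟹ BSDp E p` granted PUB and Kriz–Li 1.16**. -/

/-- **The kernel at a given frame, rank-zero input localised to the twist.**  As `bsdp_of_kolyvaginPrimitive_at_frame`, with the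
residual `RankZeroAdditive` replaced by `BSDp Wd p` for ONE globally minimal model `Wd = Cd • E^{(d_K)}` of the frame's Heegner
twist (the only curve at which the kernel consumes the residual): PUB ∧ `BSDp Wd p` ∧ «KPA′'s conclusion at this frame» ⟹
`BSDp W p`. [cite: McCallumLMS1991, §5 Cor. 5.6 (p. 310)] [cite: GrossZagier1986, V.§2] [cite: Darmon2004, Thm. 3.6]
[cite: JetchevSkinnerWan2017, §7.4.1–7.4.3] -/
theorem bsdp_of_kolyvaginPrimitive_at_frame_of_bsdp_twist (hPub : PublishedInputsAdditiveKoly)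
    (W : WeierstrassCurve ℚ) [W.IsElliptic] [W.IsGloballyMinimal] [NeZero (W.conductorNorm ℤ)] (p : ℕ) [hp : Fact p.Prime]
    (hp5 : 5 ≤ p) (hadd : Addv W p) (hr : W.analyticRank = 1) (hsurjp : W.HasSurjectiveModNGaloisRep p)
    (htam : ¬ p ∣ W.tamagawaProduct)
    (K : Type) [Field K] [NumberField K] (Dt : ModularParametrizationData W (W.conductorNorm ℤ)) (β : ℤ) (ι : K →+* ℂ)
    (hK : IsImaginaryQuadratic K) (hodd : Odd (NumberField.discr K)) (hlt : NumberField.discr K < -4)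
    (hHN : SatisfiesHeegnerHypothesis (W.conductorNorm ℤ) K)
    (hLt : (W.quadraticTwist (NumberField.discr K : ℚ)).entireLFunction 1 ≠ 0)
    (hβ : (4 * (W.conductorNorm ℤ : ℤ)) ∣ β ^ 2 - NumberField.discr K) (hc : ¬ (p : ℤ) ∣ Dt.c)
    (Wd : WeierstrassCurve ℚ) [Wd.IsElliptic] [Wd.IsGloballyMinimal] (Cd : VariableChange ℚ)
    (hWd : Cd • W.quadraticTwist (NumberField.discr K : ℚ) = Wd) (hBSDd : BSDp Wd p)
    (hKPA : ∃ (n : ℕ) (d : KolyvaginHeegnerData Dt β ι n),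
      KolyvaginDescent.KolSupp (Zhang2014.IsKolyvaginPrime (W.conductorNorm ℤ) W K p) n ∧
        d.kolyvaginClass (Fact.out : p.Prime) 1 ≠ 0) :
    BSDp W p := by
  obtain ⟨hGZ, hKo, hB, hGZK, hmod, hnf, -, hrec, hMc, h36⟩ := hPub
  have hpP : p.Prime := hp.out
  have hp2 : p ≠ 2 := by omega
  -- non-CM: a CM curve has no surjective `ρ̄_{E,ℓ}` at an odd `ℓ` (Zywina 2015, Prop. 1.14)
  have hCM : ¬ W.HasCM := fun h ↦ W.not_hasSurjectiveModNGaloisRep_of_hasCM h hpP hp2 hsurjp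
  -- step 1: `E[p]` irreducible; `ρ̄_{E,p^m}` onto for every `m` (Serre, `p ≥ 5`)
  have hirr : Irr W p := hasIrreducibleModPGaloisRep_of_hasSurjectiveModNGaloisRep W p hsurjp
  have hsurj : ∀ m : ℕ, W.HasSurjectiveModNGaloisRep (p ^ m : ℕ) :=
    serre_hasSurjectiveModNGaloisRep_pow_holds W p hp5 hsurjp
  -- step 2': the GIVEN frame, completed: Heegner datum with `β(H) = β`, Heegner point, `p ∤ d_K`, `w_K = 2`
  obtain ⟨H, hHβ⟩ := nonempty_heegnerDatum_holds (W.conductorNorm ℤ) K hK hβ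
  subst hHβ
  obtain ⟨P, hP⟩ := heegnerPointComplex_mem_range_map_holds (W.conductorNorm ℤ) W K hK hHN Dt H ι
  have hpN : p ∣ W.conductorNorm ℤ := (W.dvd_conductorNorm_iff_not_hasGoodReductionAtPrime p).mpr hadd.1
  have hpd : ¬ (p : ℤ) ∣ NumberField.discr K := not_dvd_discr_of_split hK hpP hp2 (fun q hq hqp ↦ by
    rw [(Nat.prime_dvd_prime_iff_eq hq hpP).mp hqp]; exact hHN p hpP hpN)
  have hμ : ¬ p ∣ Units.torsionOrder K := by
    haveI : IsTotallyComplex K := hK.2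
    rw [Literature.NumberTheory.DiophantineGeometry.torsionOrder_eq_two_of_discr_lt hK.1 hlt]
    intro h2
    have := Nat.le_of_dvd two_pos h2
    omega
  have h3 : NumberField.discr K ≠ -3 := by omega
  have h4 : NumberField.discr K ≠ -4 := by omega
  -- step 3: conductor-1 Kolyvagin–Heegner datum (Darmon 3.6), bottom point, non-torsion, Kolyvagin
  obtain ⟨d₁⟩ := kolyvaginRoadThree_hKD_of_darmon36 h36 W K Dt H.β ι hK hHN H.dvd_sq_sub
  have hPd : d₁.toGeomPoints d₁.derivedPoint = toGeomPoints (W.baseChange K) P :=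
    KolyvaginBottom.toGeomPoints_derivedPoint_one_eq (hrec _ W K) hK hHN hP d₁ rfl
  have hPinf : ¬ IsOfFinAddOrder P :=
    not_isOfFinAddOrder_of_heegner_of_analyticRank_eq_one W (W.conductorNorm ℤ) K Dt H ι P (hGZ _ W K)
      hmod hr hK hHN hLt hP
  obtain ⟨hrank, hSha⟩ := hKo (W.conductorNorm ℤ) W K hK hHN ⟨Dt, H, ι, hP⟩ hPinf
  haveI : Finite (W.baseChange K).sha := hSha
  -- `E(K)[p] = 0`
  have hbot := torsionBy_eq_bot_of_isImaginaryQuadratic_of_hasIrreducibleModPGaloisRep W K hK hpP hirr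
  have hiv : ∀ x : (W.baseChange K).toAffine.Point, p • x = 0 → x = 0 := fun x hx ↦ by
    have hmem : x ∈ AddSubgroup.torsionBy (W.baseChange K).toAffine.Point ((p : ℕ) : ℤ) := by
      rw [mem_torsionBy_iff, natCast_zsmul]
      exact hx
    rw [hbot] at hmem
    exact hmem
  -- `p^{M₀} ∥ y_K`
  haveI : Module.Finite ℤ (W.baseChange K).toAffine.Point := (W.baseChange K).module_finite_point_holds
  obtain ⟨M₀, x₀, hx₀, hmax⟩ := exists_pow_smul_eq_and_forall_ne hPinf (p := p) hpP.two_le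
  have hdiv : ∃ Q : (W.baseChange K).toAffine.Point, ((p ^ M₀ : ℕ) : ℤ) • Q = P :=
    ⟨x₀, by rw [natCast_zsmul]; exact hx₀⟩
  have hndiv : ¬ ∃ Q : (W.baseChange K).toAffine.Point, ((p ^ (M₀ + 1) : ℕ) : ℤ) • Q = P := by
    rintro ⟨Q, hQ⟩
    exact hmax Q (by rw [← natCast_zsmul]; exact hQ)
  -- step 4: KPA′ at this frame; McCallum ⟹ STEP L; Kolyvagin's bound ⟹ the identity
  obtain ⟨n, d, hn, hne⟩ := hKPA
  have hL : IndexLowerBoundAt W p K P :=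
    Three.Koly.indexLowerBoundAt_of_kolyvaginClass_one_ne_zero_of_mccallum W K hMc hCM hK h3 h4 hHN
      p hp2 hsurj Dt H.β ι d₁ P hPd hPinf hrank hiv hdiv hndiv d hn hne
  have hid : IndexIdentityAt W p K P :=
    indexIdentityAt_of_lowerBound_of_kolyvagin W p (hB _ W K) hK hHN ⟨Dt, H, ι, hP⟩ hPinf hp2 hsurjp
      htam hL
  -- step 5: the twist has analytic rank `0`; its `p`-part is the HYPOTHESIS `hBSDd` ⟹ print shape
  obtain ⟨-, -, hrd⟩ := twist_nonCM_addv_rankZero hmod W p hCM hadd K hK hHN hLt Wd Cd hWd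
  have htw : PPartRankZero Wd p :=
    pPartRankZero_of_pPart hGZK Wd p hrd (pPart_of_bsdp hmod hGZK Wd p (by omega) hBSDd)
  have htamEq : padicValNat p Wd.tamagawaProduct = padicValNat p W.tamagawaProduct :=
    X2.padicValNat_tamagawaProduct_twist_of_heegner_of_odd W p hp2 K hK hodd hpd hHN Cd hWd
  have hu : padicValRat p (Cd.u : ℚ) = 0 :=
    X11b.padicValRat_u_eq_zero_of_twist_minimal_of_splitsIn W p K hK.1 (hHN p hpP hpN) Cd hWd
  -- step 6: the descent `K → ℚ`
  exact X11b.bsdp_of_indexIdentityAt W p (W.conductorNorm ℤ) K Dt H ι P (hGZ _ W K) (hKo _ W K)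
    hGZK hmod hK hHN hP hp2 hc hμ hr hLt Wd Cd hWd htw htamEq hu (fun _ ↦ hid)

/-- **`BSDp (E^{(d_K)}) p ⟹ BSDp E p` on the good-avatar locus, granted PUB and Kriz–Li 1.16.**  As `bsdp_on_goodAvatarLocus`,
with the residual `RankZeroAdditive` replaced by the `p`-part of BSD for ONE globally minimal model `Wd = Cd • E^{(d_K)}` of the
frame's Heegner twist (non-CM, additive at `p`, analytic rank `0` by `twist_nonCM_addv_rankZero`).
[cite: KrizLi2019, Thm. 1.16, Rem. 1.17] [cite: McCallumLMS1991, §5 Cor. 5.6] [cite: GrossZagier1986, V.§2] -/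
theorem bsdp_on_goodAvatarLocus_of_bsdp_twist (hPub : PublishedInputsAdditiveKoly)
    (hKL : KrizLi2019.thm116_padicLogHeegner_congruence)
    (W : WeierstrassCurve ℚ) [W.IsElliptic] [W.IsGloballyMinimal] [NeZero (W.conductorNorm ℤ)] (p : ℕ) [hp : Fact p.Prime]
    (hp5 : 5 ≤ p) (hadd : Addv W p) (hr : W.analyticRank = 1) (hs : W.HasSurjectiveModNGaloisRep p)
    (hsp : ∀ (ℓ : ℕ) [Fact ℓ.Prime], W.HasMultiplicativeReductionAtPrime ℓ → ¬ p ∣ padicValInt ℓ W.minimalDiscriminantInt)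
    (K : Type) [Field K] [NumberField K] (Dt : ModularParametrizationData W (W.conductorNorm ℤ)) (β : ℤ) (ι : K →+* ℂ)
    (hK : IsImaginaryQuadratic K) (hodd : Odd (NumberField.discr K)) (hlt : NumberField.discr K < -4)
    (hH : SatisfiesHeegnerHypothesis (W.conductorNorm ℤ) K)
    (hL : (W.quadraticTwist (NumberField.discr K : ℚ)).entireLFunction 1 ≠ 0)
    (hβ : (4 * (W.conductorNorm ℤ : ℤ)) ∣ β ^ 2 - NumberField.discr K) (hc : ¬ (p : ℤ) ∣ Dt.c)
    (Wd : WeierstrassCurve ℚ) [Wd.IsElliptic] [Wd.IsGloballyMinimal] (Cd : VariableChange ℚ)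
    (hWd : Cd • W.quadraticTwist (NumberField.discr K : ℚ) = Wd) (hBSDd : BSDp Wd p)
    (hav : ∃ (W₀ : WeierstrassCurve ℚ) (_ : W₀.IsElliptic) (_ : W₀.IsGloballyMinimal) (_ : NeZero (W₀.conductorNorm ℤ))
      (Dt₀ : ModularParametrizationData W₀ (W₀.conductorNorm ℤ))
      (e : geomTorsion W (p : ℤ) ≃+ geomTorsion W₀ (p : ℤ)),
      (∀ (σ : absoluteGaloisGroup ℚ) (P : geomTorsion W (p : ℤ)), e (σ • P) = σ • e P) ∧
      W₀.HasGoodReductionAtPrime p ∧ ¬ (p : ℤ) ∣ W₀.frobeniusTrace p - 1 ∧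
      W₀.conductorNorm ℤ * p ^ 2 = W.conductorNorm ℤ ∧ ¬ (p : ℤ) ∣ Dt₀.c ∧
      ∃ (ιp : K →+* ℚ_[p]) (H₀ : HeegnerDatum (W₀.conductorNorm ℤ) (NumberField.discr K))
        (y₀ : (W₀.baseChange K).toAffine.Point),
        WeierstrassCurve.Affine.Point.map ι.toRatAlgHom y₀ = heegnerPointComplex Dt₀ H₀ ∧
          ¬ ∃ Q : (W₀.baseChange ℚ_[p]).toAffine.Point, (p : ℤ) • Q = X11b.padicPointOf W₀ p ιp y₀) :
    BSDp W p := by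
  obtain ⟨W₀, _, _, _, Dt₀, e, he, hgood₀, hna, hN₀, hc₀, ιp, hcert⟩ := hav
  have hWp : ¬ W.HasMultiplicativeReductionAtPrime p := hadd.2
  have hW₀p : ¬ W₀.HasMultiplicativeReductionAtPrime p := fun h ↦
    (WeierstrassCurve.HasMultiplicativeReduction.not_hasGoodReduction (R := ℤ_[p]) h) hgood₀
  have htype : ∀ (ℓ : ℕ) [Fact ℓ.Prime], W.HasMultiplicativeReductionAtPrime ℓ ↔ W₀.HasMultiplicativeReductionAtPrime ℓ :=
    fun ℓ _ ↦ hasMultiplicativeReductionAtPrime_iff_of_conductorNorm_eq W W₀ p hN₀ hWp hW₀p ℓ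
  have hrad : ∀ q : ℕ, q.Prime → (q ∣ p * W.conductorNorm ℤ ↔ q ∣ p * W₀.conductorNorm ℤ) :=
    fun q hq ↦ prime_dvd_mul_iff_of_mul_sq_eq hN₀ q hq
  have hsp₀ : ∀ (ℓ : ℕ) [Fact ℓ.Prime], W₀.HasMultiplicativeReductionAtPrime ℓ →
      ¬ p ∣ padicValInt ℓ W₀.minimalDiscriminantInt := by
    intro ℓ _ h₀ℓ
    have hWℓ : W.HasMultiplicativeReductionAtPrime ℓ := (htype ℓ).mpr h₀ℓ
    have hℓp : ℓ ≠ p := by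
      rintro rfl
      exact hWp hWℓ
    exact (hasMultiplicativeReductionAtPrime_and_not_dvd_of_torsionIso W W₀ p hp5 e he ℓ hℓp hWℓ (hsp ℓ hWℓ)).2
  have hsign : ∀ (ℓ : ℕ) [Fact ℓ.Prime], W₀.HasMultiplicativeReductionAtPrime ℓ → W.LFunction ℓ = W₀.LFunction ℓ :=
    sign_agreement_of_torsionCongr W W₀ p hp5 hadd hsp₀ htype e he
  have hH₀ : SatisfiesHeegnerHypothesis (W₀.conductorNorm ℤ) K := SatisfiesHeegnerHypothesis.of_dvd (Dvd.intro _ hN₀) hH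
  have htam : ¬ p ∣ W.tamagawaProduct := not_dvd_tamagawaProduct_of_spadeOne W p hp5 hsp
  exact bsdp_of_kolyvaginPrimitive_at_frame_of_bsdp_twist hPub W p hp5 hadd hr hs htam K Dt β ι hK hodd hlt hH hL hβ hc
    Wd Cd hWd hBSDd
    (kolyvaginPrimitiveAdditive_conclusion_on_gammaLocus W p K Dt β ι hKL hp5 hadd hs hK hlt hH hβ hc W₀ e he hgood₀ hna
      hrad htype hsign Dt₀ hc₀ hH₀ ιp hcert)

end Summit.BirchSwinnertonDyer.BirchSwinnertonDyer.Theorems.AdditiveKoly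

end
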